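import Mathlib
import HarnessLib
import Summits.HubbardSuperconductivity.HubbardSuperconductivity.Theorems.WeakCouplingBCSKlCertTPrimeBlockBounds

/-!
# «(KLSCAN)-TPRIME-SOUNDNESS» (5/5): the t′ WINDOW statements, hypothesis style — `kltp_window`, `kltp_window_U`, `kltp_window_zero`

Cell `gate-hubbard-kl`, seat p3 (g20); located item «(KLSCAN)-TPRIME-SOUNDNESS» (pen (R269)(D)/(R279); director INBOX l.284 KL-MARGIN-SCAN (α)).
HYPOTHESIS STYLE: the t′ = 0 soundness chain behind `klb1gd_window(_U)` (`…ChannelOps` → `…BottomStates` → `…ChannelBound` → `…ChannelFar` →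
`…BlockBounds` → `…KlCertFormD`) re-keyed VERBATIM at an arbitrary dispersion `ε` / at `squareDispersion 1 tp`, with the five analytic leaves
(finite Fermi-curve measure, `D₄` measure preservation, Hilbert–Schmidt Lindhard kernel, `D₄`-invariance of `χ₀`, channel-state existence) carried
as ONE hypothesis `KLTPAnalytic ε μ` instead of the registered `stub_kl*` leaves (which prove them at `t′ = 0`, `μ ∈ (−4,0)`: `klTPAnalytic_zero`).
Nothing here asserts a certificate at any `t′ ≠ 0`, the margin, the window or superconductivity.  `--supports stmt-HubbardSuperconductivity-0158` (helper).
References: M. Reed, B. Simon, *Methods of Modern Mathematical Physics* I Thm. VI.16/VI.23, IV Thm. XIII.5; S. Raghu, S. A. Kivelson, D. J. Scalapino,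
Phys. Rev. B 81 (2010) 224505, §II–§III.
This file: `kltp_box_certificate` (twin of `klb1gd_box_certificate` with the analytic facts as a hypothesis per `μ`), **`kltp_window`**
(`c.checkB1gD = true → (∀ bx ∈ c.boxes, ∀ μ ∈ box, KLTPAnalytic (squareDispersion 1 tp) μ) → c.EnclosuresB1gTP tp → KLB1gDominatesAtTP tp mub mua gamma`),
**`kltp_window_U`** (the `∀ U ∈ (0,1)` form), and the sanity bridge **`kltp_window_zero`** (at `tp = 0` the hypotheses are discharged by the tree on the
checker's own `(−4,0)` box range).  The UNCHANGED checker `checkB1gD` is used: in hypothesis style the μ-range / van Hove exclusion is carried by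
`KLTPAnalytic` per box (finite `σ` fails at `μ = 4t′`), so its `−4 < mulo`, `muhi < 0` literals are vestigial at `t′ ≠ 0`.
-/

noncomputable section

set_option linter.dupNamespace false

namespace Summit.HubbardSuperconductivity.HubbardSuperconductivity.Theorems

open MeasureTheory Literature.MathematicalPhysics.QuantumLattice Literature.Analysis.OperatorTheory CwKLChiralWindow
open Summit.HubbardSuperconductivity.HubbardSuperconductivity.Theorems.CwKLChiralWindow.Negative
open scoped InnerProductSpace Pointwise

/-! ## Boxes and the window at hopping `t′` (hypothesis style) -/

/-- **One box at hopping `t′`.** If a box passes `basicOKB1gD` and `b1gLeadsOK γ`, then at every `μ` of the box where the ANALYTIC FACTS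
`KLTPAnalytic (squareDispersion 1 tp) μ` hold together with the t′ Ritz enclosures of the `B1g` block and the t′ block enclosures of the four
other channels, `channelInf ε_{t′} μ 1 B1g + γ ≤ channelInf ε_{t′} μ 1 χ` for `χ ≠ B1g`.  (The checker's box-range literals `−4 < mulo`,
`muhi < 0` play no role here: the μ-range enters only through `KLTPAnalytic`.) [folklore] -/
theorem kltp_box_certificate {tp μ : ℝ} (hA : KLTPAnalytic (squareDispersion 1 tp) μ) (bx : KLBox) (tab : List KLTrig) (γ : ℚ)
    (hB : bx.basicOKB1gD tab = true) (hL : bx.b1gLeadsOK tab γ = true)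
    (hER : bx.bB1g.RitzEnclosureTP tab tp μ) (hE : ∀ χ : D4Irrep, χ ≠ D4Irrep.B1g → (bx.blk χ).EnclosureTP tab tp μ χ) :
    ∀ χ : D4Irrep, χ ≠ D4Irrep.B1g →
      channelInf (squareDispersion 1 tp) μ 1 D4Irrep.B1g + ((γ : ℚ) : ℝ) ≤ channelInf (squareDispersion 1 tp) μ 1 χ := by
  have hB' := hB
  simp only [KLBox.basicOKB1gD, Bool.and_eq_true, decide_eq_true_eq] at hB'
  obtain ⟨⟨⟨⟨⟨⟨⟨-, -⟩, -⟩, hritz⟩, hA1⟩, hA2⟩, hB2⟩, hEE⟩ := hB'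
  have hup : channelInf (squareDispersion 1 tp) μ 1 D4Irrep.B1g ≤ ((bx.bB1g.upper : ℚ) : ℝ) :=
    kltp_ritz_upper hA bx.bB1g tab D4Irrep.B1g hritz (Or.inr (by decide)) hER
  have hL' := hL
  simp only [KLBox.b1gLeadsOK, Bool.and_eq_true, decide_eq_true_eq] at hL'
  obtain ⟨⟨⟨hlA1, hlA2⟩, hlB2⟩, hlE⟩ := hL'
  have key : ∀ (χ : D4Irrep) (b : KLBlock), χ ≠ D4Irrep.B1g → bx.blk χ = b → b.lowerOKd tab χ = true →
      bx.bB1g.upper + γ ≤ b.lower tab χ →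
      channelInf (squareDispersion 1 tp) μ 1 D4Irrep.B1g + ((γ : ℚ) : ℝ) ≤ channelInf (squareDispersion 1 tp) μ 1 χ := by
    intro χ b hχ hb hok hle
    have h2 := kltp_d_blockLower hA b tab χ (hb ▸ hE χ hχ) hok
    have h3 : ((bx.bB1g.upper : ℚ) : ℝ) + ((γ : ℚ) : ℝ) ≤ ((b.lower tab χ : ℚ) : ℝ) := by exact_mod_cast hle
    linarith
  intro χ hχ
  cases χ with
  | A1g => exact key .A1g bx.bA1g (by decide) rfl hA1 hlA1
  | A2g => exact key .A2g bx.bA2g (by decide) rfl hA2 hlA2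
  | B1g => exact absurd rfl hχ
  | B2g => exact key .B2g bx.bB2g (by decide) rfl hB2 hlB2
  | E => exact key .E bx.bE (by decide) rfl hEE hlE

/-- **The t′ WINDOW statement, hypothesis style** (the target of «(KLSCAN)-TPRIME-SOUNDNESS»): an accepted record (`checkB1gD`), the
analytic facts at `(squareDispersion 1 tp, μ)` for every `μ` of every box, and the t′ enclosures `EnclosuresB1gTP c tp` give
`KLB1gDominatesAtTP tp mub mua gamma`.  At `tp = 0` the analytic facts are the tree's (`klTPAnalytic_zero`) and this is `klb1gd_window`.
[cite: RaghuKivelsonScalapino2010, §III Fig. 2 and Fig. 3] -/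
theorem kltp_window (tp : ℝ) (c : KLCert) (hc : c.checkB1gD = true)
    (hA : ∀ bx ∈ c.boxes, ∀ μ ∈ Set.Icc (bx.mulo : ℝ) (bx.muhi : ℝ), KLTPAnalytic (squareDispersion 1 tp) μ)
    (hE : c.EnclosuresB1gTP tp) :
    KLB1gDominatesAtTP tp ((c.mub : ℚ) : ℝ) ((c.mua : ℚ) : ℝ) ((c.gamma : ℚ) : ℝ) := by
  obtain ⟨-, hboxes, hcover⟩ := klb1gd_coverLogic c hc
  intro μ hμ χ hχ
  obtain ⟨bx, hbx, hlo, hhi⟩ := hcover μ hμ.1 hμ.2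
  obtain ⟨hB, hL⟩ := hboxes bx hbx
  obtain ⟨hER, hEχ⟩ := hE bx hbx μ ⟨hlo, hhi⟩
  exact kltp_box_certificate (hA bx hbx μ ⟨hlo, hhi⟩) bx c.trials c.gamma hB hL hER hEχ χ hχ

/-- **The t′ window statement at every weak coupling, hypothesis style**: `KLB1gDominatesTP tp mub mua gamma` (`U²`-homogeneity of the
`B1g` bottom and the bare-`U` penalty from the analytic facts). [cite: RaghuKivelsonScalapino2010, §II (7), (13)] -/
theorem kltp_window_U (tp : ℝ) (c : KLCert) (hc : c.checkB1gD = true)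
    (hA : ∀ bx ∈ c.boxes, ∀ μ ∈ Set.Icc (bx.mulo : ℝ) (bx.muhi : ℝ), KLTPAnalytic (squareDispersion 1 tp) μ)
    (hE : c.EnclosuresB1gTP tp) :
    KLB1gDominatesTP tp ((c.mub : ℚ) : ℝ) ((c.mua : ℚ) : ℝ) ((c.gamma : ℚ) : ℝ) := by
  obtain ⟨-, -, hcover⟩ := klb1gd_coverLogic c hc
  intro μ hμ U hU χ hχ
  obtain ⟨bx, hbx, hlo, hhi⟩ := hcover μ hμ.1 hμ.2
  have hAμ := hA bx hbx μ ⟨hlo, hhi⟩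
  have hhom : channelInf (squareDispersion 1 tp) μ U D4Irrep.B1g =
      U ^ 2 * channelInf (squareDispersion 1 tp) μ 1 D4Irrep.B1g :=
    kltp_hs_channelInf_sq hAμ U D4Irrep.B1g
      (fun ψ hψ => (stub_klMeanZero _ _ hAμ.1 hAμ.2.1 D4Irrep.B1g ψ (by decide) hψ).2)
  have hpen : U ^ 2 * channelInf (squareDispersion 1 tp) μ 1 χ ≤ channelInf (squareDispersion 1 tp) μ U χ :=
    kltp_hs_sq_channelInf_one_le hAμ hU.1 hU.2.le χ
  have h1 := mul_le_mul_of_nonneg_left (kltp_window tp c hc hA hE μ hμ χ hχ) (sq_nonneg U)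
  rw [hhom]
  nlinarith

/-- **Sanity: at `t′ = 0` the hypothesis-style window IS the tree's** (every accepted t′ = 0 record satisfies the analytic hypotheses by
`klTPAnalytic_zero`, its boxes lying in `(−4, 0)` by `checkB1gD`). [folklore] -/
theorem kltp_window_zero (c : KLCert) (hc : c.checkB1gD = true) (hE : c.EnclosuresB1gTP 0) :
    KLB1gDominatesAtTP 0 ((c.mub : ℚ) : ℝ) ((c.mua : ℚ) : ℝ) ((c.gamma : ℚ) : ℝ) := by
  refine kltp_window 0 c hc (fun bx hbx μ hμ => ?_) hE
  obtain ⟨-, hboxes, -⟩ := klb1gd_coverLogic c hc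
  have hB := (hboxes bx hbx).1
  simp only [KLBox.basicOKB1gD, Bool.and_eq_true, decide_eq_true_eq] at hB
  obtain ⟨⟨⟨⟨⟨⟨⟨h4, -⟩, h0⟩, -⟩, -⟩, -⟩, -⟩, -⟩ := hB
  have hμ' : μ ∈ Set.Ioo (-4 : ℝ) 0 :=
    ⟨lt_of_lt_of_le (by exact_mod_cast h4) hμ.1, lt_of_le_of_lt hμ.2 (by exact_mod_cast h0)⟩
  exact klTPAnalytic_zero hμ'

end Summit.HubbardSuperconductivity.HubbardSuperconductivity.Theorems

end
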